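import Mathlib.Analysis.SpecialFunctions.Pow.Real
import Mathlib.Analysis.SpecialFunctions.Log.Basic
import Mathlib.Analysis.MeanInequalities
import HarnessLib

/-!
# K2R `RealisedQuasiStaticCellLaw`, line `floquet-bloch`, stub `stub_upperSome`: the scalar slow/fast recursion of the
# principal pair (cone invariant, two-point Jensen step, telescoped lower bound)

Summits-side helper (everything proved; no definitions, no named facts; `--supports stmt-AnomalousDissipation-20446`).
Pure real-variable bookkeeping of the `stub_upperSome` lane. At the slot boundaries `i = 0, 1, 2, …` let `x_i` be the slow
energy `‖α_N(ℓ)‖²`, `R_i` the fast energy of the sector truncation, `w^o_i + w^i_i = 1` the polarisation weights of the slow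
vector in the frame of slot `i` and `θ^o_i, θ^i_i ∈ [3/4, 1]` the two block factors of `sector_slot_lower`, `c_i` the cone
feed and `θ_f ≤ 1/4` the fast contraction of `sector_slot_cone`. From
`(w^oθ^o + w^iθ^i) x_i − (β/2)R_i ≤ x_{i+1}` and `R_{i+1} ≤ θ_f R_i + c_i(2x_i + R_i)` with `12c_i ≤ η ≤ 1`, `βη ≤ 1/2`,
`R_0 ≤ ηx_0` (no sign hypothesis on `R` is needed):
* `cone_recursion` — for all `i`: `R_i ≤ ηx_i`, `x_i > 0`, `x_{i+1} ≥ x_i/2` and the log step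
  `log x_{i+1} ≥ log x_i + (w^o_i log θ^o_i + w^i_i log θ^i_i) − βη` (two-point Jensen for `log`,
  `Real.geom_mean_le_arith_mean2_weighted`);
* `cone_recursion_sum` — the telescoped form over `i ∈ [k, m)`.
Energy LOWER-bound half of the K2R bracket; not anomalous dissipation.
-/

set_option linter.dupNamespace false -- layout D-0017: `AnomalousDissipation.AnomalousDissipation` repeats by design

namespace Summit.AnomalousDissipation.AnomalousDissipation.Theorems.SolenoidalFractalHomogenisation.RealisedQuasiStaticCellLaw

noncomputable section

open Finset
open scoped BigOperators

/-- Two-point Jensen inequality for the logarithm: `w₁ log p₁ + w₂ log p₂ ≤ log(w₁p₁ + w₂p₂)` for weights `w₁ + w₂ = 1`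
and `p₁, p₂ > 0`. -/
theorem log_two_point_jensen {w₁ w₂ p₁ p₂ : ℝ} (hw₁ : 0 ≤ w₁) (hw₂ : 0 ≤ w₂) (hw : w₁ + w₂ = 1) (hp₁ : 0 < p₁)
    (hp₂ : 0 < p₂) : w₁ * Real.log p₁ + w₂ * Real.log p₂ ≤ Real.log (w₁ * p₁ + w₂ * p₂) := by
  have hgm := Real.geom_mean_le_arith_mean2_weighted hw₁ hw₂ hp₁.le hp₂.le hw
  have hpos : 0 < p₁ ^ w₁ * p₂ ^ w₂ := mul_pos (Real.rpow_pos_of_pos hp₁ _) (Real.rpow_pos_of_pos hp₂ _)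
  have hlog := Real.log_le_log hpos hgm
  rw [Real.log_mul (Real.rpow_pos_of_pos hp₁ _).ne' (Real.rpow_pos_of_pos hp₂ _).ne', Real.log_rpow hp₁,
    Real.log_rpow hp₂] at hlog
  exact hlog

/-- For `0 < θ` and `u < θ`: `log θ − u/(θ − u) ≤ log(θ − u)` (from `1 − x⁻¹ ≤ log x`). -/
theorem log_sub_ge {θ u : ℝ} (hθ : 0 < θ) (huθ : u < θ) :
    Real.log θ - u / (θ - u) ≤ Real.log (θ - u) := by
  have hpos : 0 < θ - u := by linarith
  have h1 := Real.one_sub_inv_le_log_of_pos (div_pos hpos hθ)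
  rw [Real.log_div hpos.ne' hθ.ne'] at h1
  have h2 : 1 - ((θ - u) / θ)⁻¹ = -(u / (θ - u)) := by
    rw [inv_div]
    field_simp
    ring
  linarith

/-- **The slow/fast cone recursion.** See the module docstring: cone invariant, positivity, one-slot loss at most a
factor `2`, and the log step with the polarisation-weighted exponent. -/
theorem cone_recursion (x R wo wi θo θi c : ℕ → ℝ) (θf β η : ℝ)
    (hx0 : 0 < x 0) (hR0 : R 0 ≤ η * x 0)
    (hw : ∀ i, 0 ≤ wo i ∧ 0 ≤ wi i ∧ wo i + wi i = 1)
    (hθ : ∀ i, 3 / 4 ≤ θo i ∧ θo i ≤ 1 ∧ 3 / 4 ≤ θi i ∧ θi i ≤ 1)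
    (hslow : ∀ i, (wo i * θo i + wi i * θi i) * x i - β / 2 * R i ≤ x (i + 1))
    (hfast : ∀ i, R (i + 1) ≤ θf * R i + c i * (2 * x i + R i))
    (hθf : 0 ≤ θf) (hθf4 : θf ≤ 1 / 4) (hc : ∀ i, 0 ≤ c i ∧ 12 * c i ≤ η) (hη : 0 ≤ η) (hη1 : η ≤ 1)
    (hβ : 0 ≤ β) (hβη : β * η ≤ 1 / 2) :
    ∀ i, R i ≤ η * x i ∧ 0 < x i ∧ x i / 2 ≤ x (i + 1) ∧
      Real.log (x i) + (wo i * Real.log (θo i) + wi i * Real.log (θi i)) - β * η ≤ Real.log (x (i + 1)) := by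
  -- the one-step consequences of the cone
  have step : ∀ i, R i ≤ η * x i → 0 < x i →
      x i / 2 ≤ x (i + 1) ∧ R (i + 1) ≤ η * x (i + 1) ∧
        Real.log (x i) + (wo i * Real.log (θo i) + wi i * Real.log (θi i)) - β * η ≤ Real.log (x (i + 1)) := by
    intro i hRi hxi
    obtain ⟨hwo, hwi, hsum⟩ := hw i
    obtain ⟨hθo1, hθo2, hθi1, hθi2⟩ := hθ i
    obtain ⟨hc0, hc12⟩ := hc i
    set θb : ℝ := wo i * θo i + wi i * θi i with hθb
    have hθb1 : 3 / 4 ≤ θb := by rw [hθb]; nlinarith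
    have hθb2 : θb ≤ 1 := by rw [hθb]; nlinarith
    have hβR : β / 2 * R i ≤ β * η / 2 * x i := by nlinarith
    -- slow lower step
    have hx1 : (θb - β * η / 2) * x i ≤ x (i + 1) := by nlinarith [hslow i]
    have hhalf : x i / 2 ≤ x (i + 1) := by nlinarith
    have hx1pos : 0 < x (i + 1) := by linarith
    refine ⟨hhalf, ?_, ?_⟩
    · -- cone propagates
      have h1 : R (i + 1) ≤ θf * (η * x i) + c i * (2 * x i + η * x i) := by
        have := hfast i; nlinarith
      have p1 : θf * (η * x i) ≤ 1 / 4 * (η * x i) := mul_le_mul_of_nonneg_right hθf4 (by positivity)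
      have p2 : c i * (2 * x i + η * x i) ≤ c i * (3 * x i) := mul_le_mul_of_nonneg_left (by nlinarith) hc0
      have p3 : 12 * c i * x i ≤ η * x i := mul_le_mul_of_nonneg_right hc12 hxi.le
      have p4 : η * (x i / 2) ≤ η * x (i + 1) := mul_le_mul_of_nonneg_left hhalf hη
      linarith
    · -- the log step
      have hfac : 0 < θb - β * η / 2 := by linarith
      have hlog1 : Real.log ((θb - β * η / 2) * x i) ≤ Real.log (x (i + 1)) :=
        Real.log_le_log (mul_pos hfac hxi) hx1
      rw [Real.log_mul hfac.ne' hxi.ne'] at hlog1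
      have hlog2 := log_sub_ge (u := β * η / 2) (by linarith : 0 < θb) (by linarith)
      have hlog3 : β * η / 2 / (θb - β * η / 2) ≤ β * η := by
        rw [div_le_iff₀ hfac]
        have : 0 ≤ β * η := by positivity
        nlinarith
      have hj := log_two_point_jensen hwo hwi hsum (by linarith : 0 < θo i) (by linarith : 0 < θi i)
      linarith
  intro i
  induction i with
  | zero =>
    obtain ⟨h1, _, h3⟩ := step 0 hR0 hx0
    exact ⟨hR0, hx0, h1, h3⟩
  | succ k ih =>
    obtain ⟨hRk, hxk, _, _⟩ := ih
    obtain ⟨hhalf, hRk1, _⟩ := step k hRk hxk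
    have hxk1 : 0 < x (k + 1) := by linarith
    obtain ⟨h1, _, h3⟩ := step (k + 1) hRk1 hxk1
    exact ⟨hRk1, hxk1, h1, h3⟩

/-- **Telescoped form.** Under the hypotheses of `cone_recursion`, for `k ≤ m`:
`log x_m ≥ log x_k + Σ_{i∈[k,m)} (w^o_i log θ^o_i + w^i_i log θ^i_i) − (m − k)βη`. -/
theorem cone_recursion_sum (x R wo wi θo θi c : ℕ → ℝ) (θf β η : ℝ)
    (hx0 : 0 < x 0) (hR0 : R 0 ≤ η * x 0)
    (hw : ∀ i, 0 ≤ wo i ∧ 0 ≤ wi i ∧ wo i + wi i = 1)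
    (hθ : ∀ i, 3 / 4 ≤ θo i ∧ θo i ≤ 1 ∧ 3 / 4 ≤ θi i ∧ θi i ≤ 1)
    (hslow : ∀ i, (wo i * θo i + wi i * θi i) * x i - β / 2 * R i ≤ x (i + 1))
    (hfast : ∀ i, R (i + 1) ≤ θf * R i + c i * (2 * x i + R i))
    (hθf : 0 ≤ θf) (hθf4 : θf ≤ 1 / 4) (hc : ∀ i, 0 ≤ c i ∧ 12 * c i ≤ η) (hη : 0 ≤ η) (hη1 : η ≤ 1)
    (hβ : 0 ≤ β) (hβη : β * η ≤ 1 / 2) {k m : ℕ} (hkm : k ≤ m) :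
    Real.log (x k) + ∑ i ∈ Finset.Ico k m, (wo i * Real.log (θo i) + wi i * Real.log (θi i)) - (m - k : ℝ) * (β * η) ≤
      Real.log (x m) := by
  have H := cone_recursion x R wo wi θo θi c θf β η hx0 hR0 hw hθ hslow hfast hθf hθf4 hc hη hη1 hβ hβη
  induction m, hkm using Nat.le_induction with
  | base => simp
  | succ m hkm ih =>
    rw [Finset.sum_Ico_succ_top hkm]
    have h := (H m).2.2.2
    push_cast
    linarith

end

end Summit.AnomalousDissipation.AnomalousDissipation.Theorems.SolenoidalFractalHomogenisation.RealisedQuasiStaticCellLaw
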